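import Summits.AtomisticToContinuum.Crystallization.Theorems.ChartedZeroExcessLayeredLatticeLiouvilleUL

/-!
# Zero-excess layered lattice Liouville — part UM (lens-2 g53, node «BondIsoGermDichotomy»): the cap lemma «BondIsoTiltCap» STATED AND RESOLVED —
# germs of a bond-isomorphic registration (the link-map dichotomy in Lean terms), the cap family [Capᵇ_c] `BondIsoTiltCapBPG c`, and the PROVED seams
# `c ≤ ϑ ⇒ ([Capᵇ_c] ⇒ [Tᵇ] ⇒ [T_bᵇ])`, `[Capᵇ_c] ⇒ [PGᵇ_c]`, vacuity at `c = 12` / `c = 56/25`, and the registration half of the proper seed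

Continuation of part UL (critic row 846 (iv): «state and attack the cap lemma — pointwise `σ x ≤ C·(…)` on interior good sites under `IsBondIso S Ψ` …
give the link-map dichotomy in Lean terms»).  ONE QUESTION, TWO REGIMES — the verdict of this part:

* THE CAP FAMILY [Capᵇ_c] `BondIsoTiltCapBPG c aHi Λ θ s` (§ZM.2): with [T]'s binder prefix and the clause `IsBondIso S Ψ`, the GIVEN registration `Ψ`
  carries tilt–strain data `(Q, σ)` (part TR) on `win 9R` with `σ x ≤ c` at EVERY site.  Antitone in `c`; TRIVIAL at `c = 12` (PROVED, `Q ≡ 1`).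
  - LARGE caps, `c ≥ c_geo` (first shell: `c_iso ≈ 0.27` sharp; radius `4`: between `≈ 0.45` for locally uniform scale/orientation and `O(1)` under
    worst-case clean drift — two-shell cleanliness lets orientation and scale drift by `O(θ)` per shell; trivial cap `12`): GEOMETRY — TRUE-type and
    PROVABLE·M from LINK RIGIDITY (below); useless for (Mᵇ), whose content is at thresholds `t₀ ↓ 0`.
  - SMALL caps, `c ≤ ϑ = tameRadius = 1/20`: `[Capᵇ_c] ⇒ [Tᵇ]` IS PROVED HERE (`tameWindowBPG_of_bondIsoTiltCapBPG`, one line through part UC's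
    dictionary `isTameOn_of_tiltStrainData`), hence `⇒ [T_bᵇ]` and the small cap REPLACES [T_bᵇ] in the docket of record
    (`strainNonConcentrationBPG_1_50_of_cap`).  So a small cap is NOT a lemma beneath the line but a statement AT LEAST AS STRONG AS ITS [T]-AXIS
    (Liouville / ε-regularity strength: pointwise smallness of the intrinsic strain of a defect-free GSC equilibrium) — under the embargo of critic rows
    780/792 it is recorded as a DOMINATING REFORMULATION, not filed as a cut.  It is also NOT LOCAL: two-shell cleanliness `(1/16, 9/10, 1)`, θ-goodness and
    the bond isomorphism leave the local scale `a_x ∈ [9/10, 1]` free site by site, so a slowly «breathing» clean bond-isomorphic patch (radial scale drift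
    `9/10 → 1` over `≳ 3` shells) has first-shell germ misfit `≥ 1/10` and `σ(centre) ≥ 0.36` under ANY rotation field; only force balance (Nash) and
    e⋆-GSC can pin the scale — the geometric mechanism «shell rigidity ⇒ small cap» is dead, the statement on door sets is the [T]-question itself.
* THE LINK-MAP DICHOTOMY (§ZM.1, §ZM.3): the GERM of `Ψ` at `x` is its restriction to the closed first shell (bonds `≤ 28/25`); `IsGermFit c S Ψ x g` says the
  linear isometry `g` fits it within `c`; a germ is PROPER (`det g = 1`) or IMPROPER (`det g = −1`) within `c`.  [LRᵇ_c] `LinkRigidityBP` (every germ of a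
  bond isomorphism of a θ-good P-door set onto an equilibrium chart lattice is proper-or-improper within `c`; GEOMETRY, no budget) and [PGᵇ_c] `ProperGermBPG`
  (under [T]'s prefix every germ on `win 9R` is PROPER within `c`) are typed; `[Capᵇ_c] ⇒ [PGᵇ_c]` and both vacuities at `c ≥ 56/25` are PROVED, and so is
  the registration half of the PROPER SEED (`exists_profile_lt_of_globalReg`: at level `Cg·η < t²` some site of `win R` has registration profile `< t`).
  MECHANISM of [LRᵇ]/[PGᵇ] for `c ≳ c_iso ≈ 0.27` (instrument-free enumeration, lens-2 g53 folder `calc/links.py` + `calc/tripod.py`, seconds; NODE-g53 §1):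
  (i) the link graph of a site of a Barlow packing is the cuboctahedron (c-site, 48 automorphisms) or the anticuboctahedron (h-site, 12 automorphisms) and
  EVERY link automorphism is realised by a linear isometry of the ideal cluster (48/48 resp. 12/12; exactly half proper); on `(1/16, 9/10, 1)`-clean sets the
  relation `dist ≤ 28/25` IS first-shell adjacency (`17/16 < 28/25 < (9/10)(√2 − 1/16)`), so a bond isomorphism restricted to a closed first shell is a
  labelled link isomorphism, within `c_sim ≈ 1/16 + 1/16 + s ≈ 0.145` of a SIMILARITY realising it (scale ratio `a_{Ψx}/a_x ∈ [9/10, 10/9]`, both sets'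
  shell tolerances, chart flex `s`) and within `c_iso ≈ c_sim + (1/9)(17/16) ≈ 0.27` of a linear ISOMETRY; (ii) UNIQUE CONTINUATION: a contact-graph
  embedding of the radius-`4` ball (381 fcc / 389 hcp sites, graph radius `5`) into the same pattern is determined by its first-shell germ (0 ambiguous
  steps in the shell-by-shell placement: each further site is the unique unplaced common neighbour of its placed neighbours); (iii) HANDEDNESS CONTINUES
  ALONG BONDS: bonded sites `x, y` share a labelled near-regular tetrahedron; the germs `g_x, g_y` agree within `2c_x + c_y` on the labelled corner tripod at
  `y`, whose chirality gap is `≈ 0.853·edge ≥ 0.72` (edge `≥ (9/10)(15/16)`; `calc/tripod.py`) — so handedness is inherited when `2c_x + c_y < 0.72`: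
  TRUE for similarity germs (`3·c_sim ≈ 0.44`), MARGINALLY FALSE for isometry germs at worst-case scales (`3·c_iso ≈ 0.8`); the continuation is therefore
  run on similarity germs and converted to isometries at the end (`+ (1/9)(17/16)`), landing [PGᵇ_c]/[LRᵇ_c]-with-handedness for `c ≳ 0.27` (the typed
  pieces keep isometries, matching part TR's data); (iv) PROPER SEED: an improper germ has identity misfit `≥ 0.84·√2 − c ≈ 1.19 − c > 1/2` (`c < 0.69`),
  impossible at a site of registration profile `< 1/2`, which exists once `Cg·η < 1/4` (PROVED half); with (iii) and the connectedness of the clean contact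
  graph (parts TearFreeDoor/TearFreeWalk) every germ is proper.
  CONSEQUENCE FOR THE LINE (the dichotomy's payoff is DEFECT EXCLUSION, not a cap): composing with the charting bijection `Φ` of `IsCharted`, `Ψ ∘ Φ` is a
  contact-graph isomorphism between two PERFECT layered close packings (`barlowStacking 1 √(2/3) s` and the chart lattice), hence — by (i)+(ii) — RIGID
  (layer-wise affine with one global linear part: the structured class of part TG §X «determined by one site's neighbourhood», now with the enumeration
  behind it).  In the ᵇ-class the tilt–strain data of `Ψ` ARE the intrinsic strain field of `S` measured against the chart metric, the re-registration
  freedom of (Mᵇ) is void (any registration with profile `< 1/2` on a connected region agrees with `Ψ` there up to a symmetry of the chart lattice), and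
  the special (combinatorial-defect) branch of the lens is EMPTY: (Mᵇ) is the `L³`-higher-integrability and [T_bᵇ] the `L^∞`-ε-regularity of ONE scalar
  field — the intrinsic strain deviation of a defect-free, clean, single-site-Nash, e⋆-GSC configuration — a Meyers–Gehring / ε-regularity question for
  the discrete quasilinear elliptic system of force balance on the clean range, with no combinatorial residue.
* PROOF-USAGE TEST (critic row 846 (iv)(2), NODE-g53 §2): the coherent-window Caccioppoli inequality [CC°_Wᵇ] is proved (part UD's mechanism: Gårding +
  cut-off against EXACT force balance) by a site-by-site second-order expansion at EVERY site of `supp ζ` at EVERY scale `r ≤ 8R` — it uses pointwise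
  coherence (count of incoherent sites = 0), i.e. MORE than any sub-cap site count at positive density `ε·η`; such a count is absorbable into the floor
  `A·η` only for radii `r ≤ (κ + Aη)/(εη√κ)`, not uniformly in `r` (`R` is unbounded above).  Hence the count form «StrainedSiteCountBPG» is NOT typed:
  modulo no cap at all it is (M♭ᵇ)₀ again (`t₀²·#{σ ≥ t₀} ≤ strainMassAbove t₀ σ ≤ 144·#{σ ≥ t₀}` after truncation at `12`), i.e. part UJ's
  `strainNonConcentrationBPG_iff_strainSparseBPG_zero` restated — churn by the cell's rule; the docket of record is unchanged.
No `sorry`, no new axiom, no instance / notation / option.  Literature: T. C. Hales, arXiv 1209.6043 (2012) (12-kissing packings are Barlow: rigidity of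
saturated contact structure — context for (i)/(ii), not used); K. Böröczky – L. Szabó, Acta Math. Hungar. 146 (2015) 421; parts TG (§X), TR, UC, UD, UJ–UL.
-/

noncomputable section

open scoped BigOperators
open MeasureTheory Set Metric Filter Topology
open Summit.AtomisticToContinuum.Crystallization.Theorems.ChartedPlanarOrderRigidityDoor (E3 atomsIn)
open Summit.AtomisticToContinuum.Crystallization.Theorems.ChartedPlanarOrderDensityDichotomy (μS IsSep nK nK_nonneg)
open Summit.AtomisticToContinuum.Crystallization.Theorems.ChartedPlanarOrderCleanScaleP (IsCleanP IsDoorSetP)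
open Summit.AtomisticToContinuum.Crystallization.Theorems.ChartedPlanarOrderMesoCut (LayeredHom EnvClose)
open Summit.AtomisticToContinuum.Crystallization.Theorems.ChartedPlanarOrderDoorLayered (atomsIn_subset)
open Summit.AtomisticToContinuum.Crystallization.Theorems.ChartedPlanarOrderDoorLayeredOsc (IsTwoShellAffineGood)
open Literature.Analysis.PDE (finavg ZatorskaGoldstein2005_localGehringLemmaCounting)

namespace Summit.AtomisticToContinuum.Crystallization.Theorems.ChartedZeroExcessLayeredLatticeLiouville

/-! ### ZM.1  Germs of a registration: fit by a linear isometry, proper / improper -/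

/-- **`IsGermFit c S Ψ x g`** — the GERM of `Ψ` at `x` (its restriction to the closed first shell of `x`: sites `p ∈ S` with `dist p x ≤ 28/25`, the
bond relation of `IsBondIso` / `IsCharted`) is fitted by the linear isometry `g` within `c`: every first-shell bond `p − x`, once moved by `g`, matches
the image bond `Ψ p − Ψ x` within `c`.  The first-shell analogue of part TR's tilt–strain misfit (radius `4` there). [this file, g53] -/
def IsGermFit (c : ℝ) (S : Set E3) (Ψ : E3 → E3) (x : E3) (g : E3 ≃ₗᵢ[ℝ] E3) : Prop :=
  ∀ p ∈ S, dist p x ≤ 28 / 25 → dist (g (p - x)) (Ψ p - Ψ x) ≤ c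

/-- **`IsProperGerm c S Ψ x`** — some ROTATION (`det = 1`) fits the germ of `Ψ` at `x` within `c`. [this file, g53] -/
def IsProperGerm (c : ℝ) (S : Set E3) (Ψ : E3 → E3) (x : E3) : Prop :=
  ∃ g : E3 ≃ₗᵢ[ℝ] E3, LinearMap.det (g.toLinearEquiv : E3 →ₗ[ℝ] E3) = 1 ∧ IsGermFit c S Ψ x g

/-- **`IsImproperGerm c S Ψ x`** — some ROTOREFLECTION (`det = −1`) fits the germ of `Ψ` at `x` within `c`.  For `c` below half the chirality gap of the
labelled link (gap `≈ 1.414·a` cuboctahedral, `≈ 1.636·a` anticuboctahedral, NODE-g53 §1) a germ is not both; for `c ≥ c_iso ≈ 0.27` it is one of the two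
([LRᵇ_c], §ZM.3). [this file, g53] -/
def IsImproperGerm (c : ℝ) (S : Set E3) (Ψ : E3 → E3) (x : E3) : Prop :=
  ∃ g : E3 ≃ₗᵢ[ℝ] E3, LinearMap.det (g.toLinearEquiv : E3 →ₗ[ℝ] E3) = -1 ∧ IsGermFit c S Ψ x g

/-- germ fits are monotone in the tolerance. [this file, g53] -/
theorem IsGermFit.mono {c c' : ℝ} (h : c ≤ c') {S : Set E3} {Ψ : E3 → E3} {x : E3} {g : E3 ≃ₗᵢ[ℝ] E3} (hf : IsGermFit c S Ψ x g) :
    IsGermFit c' S Ψ x g := fun p hp hpx => (hf p hp hpx).trans h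

/-- properness within `c` is monotone in `c`. [this file, g53] -/
theorem IsProperGerm.mono {c c' : ℝ} (h : c ≤ c') {S : Set E3} {Ψ : E3 → E3} {x : E3} (hx : IsProperGerm c S Ψ x) : IsProperGerm c' S Ψ x := by
  obtain ⟨g, hg, hf⟩ := hx
  exact ⟨g, hg, hf.mono h⟩

/-- improperness within `c` is monotone in `c`. [this file, g53] -/
theorem IsImproperGerm.mono {c c' : ℝ} (h : c ≤ c') {S : Set E3} {Ψ : E3 → E3} {x : E3} (hx : IsImproperGerm c S Ψ x) :
    IsImproperGerm c' S Ψ x := by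
  obtain ⟨g, hg, hf⟩ := hx
  exact ⟨g, hg, hf.mono h⟩

/-- VACUITY GUARD: under a bond isomorphism the IDENTITY fits every germ within `56/25` (both bonds have length `≤ 28/25`) — the content of a germ fit
is in `c < 56/25`, that of the dichotomy in `c` below the chirality gap. [this file, g53] -/
theorem isGermFit_refl_of_bondIso {S : Set E3} {Ψ : E3 → E3} (hB : IsBondIso S Ψ) {x : E3} (hx : x ∈ S) :
    IsGermFit (56 / 25) S Ψ x (LinearIsometryEquiv.refl ℝ E3) := by
  intro p hp hpx
  have h1 : dist (Ψ p) (Ψ x) ≤ 28 / 25 := (hB x hx p hp).1 hpx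
  show dist (p - x) (Ψ p - Ψ x) ≤ 56 / 25
  rw [dist_eq_norm]
  calc ‖p - x - (Ψ p - Ψ x)‖ ≤ ‖p - x‖ + ‖Ψ p - Ψ x‖ := norm_sub_le _ _
    _ = dist p x + dist (Ψ p) (Ψ x) := by rw [dist_eq_norm, dist_eq_norm]
    _ ≤ 28 / 25 + 28 / 25 := add_le_add hpx h1
    _ = 56 / 25 := by norm_num

/-- hence every germ of a bond isomorphism is PROPER within `56/25` (rotation `1`). [this file, g53] -/
theorem isProperGerm_of_bondIso {S : Set E3} {Ψ : E3 → E3} (hB : IsBondIso S Ψ) {x : E3} (hx : x ∈ S) : IsProperGerm (56 / 25) S Ψ x :=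
  ⟨LinearIsometryEquiv.refl ℝ E3, det_refl_E3_eq_one, isGermFit_refl_of_bondIso hB hx⟩

/-- DICTIONARY: tilt–strain data `(Q, σ)` of `Ψ` on `win R` (part TR, radius `4 ≥ 28/25`) fit the germ at `x ∈ win R` by the rotation `Q x` within `σ x`.
[this file, g53] -/
theorem isGermFit_of_tiltStrainData {S : Set E3} {R : ℝ} {Ψ : E3 → E3} {Q : E3 → (E3 ≃ₗᵢ[ℝ] E3)} {σ : E3 → ℝ}
    (hd : IsTiltStrainData S R Ψ Q σ) {x : E3} (hx : x ∈ atomsIn (μS S) 0 R) : IsGermFit (σ x) S Ψ x (Q x) :=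
  fun p hp hpx => hd.2.2 x hx p hp (hpx.trans (by norm_num))

/-- DICTIONARY: tilt–strain data with `σ x ≤ c` make the germ at `x` PROPER within `c`. [this file, g53] -/
theorem isProperGerm_of_tiltStrainData {S : Set E3} {R : ℝ} {Ψ : E3 → E3} {Q : E3 → (E3 ≃ₗᵢ[ℝ] E3)} {σ : E3 → ℝ}
    (hd : IsTiltStrainData S R Ψ Q σ) {x : E3} (hx : x ∈ atomsIn (μS S) 0 R) {c : ℝ} (hσ : σ x ≤ c) : IsProperGerm c S Ψ x :=
  ⟨Q x, hd.1 x, (isGermFit_of_tiltStrainData hd hx).mono hσ⟩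

/-! ### ZM.2  The cap family [Capᵇ_c] «BondIsoTiltCapBPG» and its place: `c ≤ ϑ ⇒ ([Capᵇ_c] ⇒ [Tᵇ])` -/

/-- ★★ **[Capᵇ_c] «BondIsoTiltCapBPG c aHi Λ θ s» — THE CAP LEMMA OF CRITIC ROW 846, TYPED.**  With [T]'s binder prefix (`∀ δ a Cg K₀ ∃ η₁ R₁`; θ-good GSC
door set, level `η ≤ η₁`, radius `R ≥ R₁`, equilibrium `s`-chart `(L, w)`, global registration `Ψ` at `(Cg, η, R)` that is a BOND ISOMORPHISM, fat window):
the GIVEN `Ψ` admits tilt–strain data `(Q, σ)` on `win 9R` (part TR: `det Q x = 1`, every `4`-bond at `x` rotated by `Q x` matches its image within `σ x`)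
with the POINTWISE CAP `σ x ≤ c` at every site of `win 9R`.  Antitone in `c` (`BondIsoTiltCapBPG.anti`); TRIVIAL at `c = 12` (`bondIsoTiltCapBPG_twelve`).
REGIMES (module docstring): `c ≥ c_geo` (radius `4`: `≈ 0.45`–`O(1)`, trivial `12`) GEOMETRY · TRUE-type · PROVABLE·M (link rigidity + unique continuation,
NODE-g53 §1) · useless for (Mᵇ);
`c ≤ tameRadius`: `⇒ [Tᵇ] ⇒ [T_bᵇ]` PROVED below — LIOUVILLE-strength (ε-regularity of the intrinsic strain of a defect-free GSC equilibrium) · GSC-priced ·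
UNDECIDED · NOT LOCAL (breathing patch: cleanliness + θ-goodness + bond-iso leave the local scale free) · under the embargo of critic rows 780/792 a
DOMINATING REFORMULATION of the [T]-axis in the ᵇ-class, not a cut.
Why it might fail (small `c`): exactly as [T]/[T_b] — a defect-free, clean, single-site-Nash, e⋆-GSC elastic anomaly with intrinsic strain `≥ c/4` on a
`4`-ball; none known, none seen (census TAG 174 (a⁗): wild mass at `1/20` zero on 54 windows), no theorem excludes it.
Sources: critic row 846 (iv); parts TR (`IsTiltStrainData`), UC ([T], `isTameOn_of_tiltStrainData`), UK ([Tᵇ], [T_bᵇ]), TG §X; Hales, arXiv 1209.6043 (context). [this file, g53] -/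
def BondIsoTiltCapBPG (c aHi Λ θ s : ℝ) : Prop :=
  ∀ δ : ℝ, 0 < δ → ∀ a : ℝ, 0 < a → ∀ Cg : ℝ, 1 ≤ Cg → ∀ K₀ : ℝ, 0 < K₀ → ∃ η₁ : ℝ, 0 < η₁ ∧ ∃ R₁ : ℝ, 0 < R₁ ∧
    ∀ S : Set E3, IsDoorSetPG aHi δ S → (∀ q ∈ S, IsTwoShellAffineGood θ S q) →
      ∀ η : ℝ, 0 < η → η ≤ η₁ → ∀ R : ℝ, R₁ ≤ R →
        ∀ (L : E3 ≃L[ℝ] E3) (w : ℤ → E3), IsEquilChart a s Λ L w →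
          ∀ Ψ : E3 → E3, IsGlobalReg Cg η R S (LayeredHom (L : E3 →L[ℝ] E3) w) Ψ → IsBondIso S Ψ →
            K₀ ≤ η * nK (atomsIn (μS S) 0 R) →
              ∃ (Q : E3 → (E3 ≃ₗᵢ[ℝ] E3)) (σ : E3 → ℝ), IsTiltStrainData S (9 * R) Ψ Q σ ∧ ∀ x ∈ atomsIn (μS S) 0 (9 * R), σ x ≤ c

/-- the cap family is antitone in the cap: a smaller cap is a stronger statement. [this file, g53] -/
theorem BondIsoTiltCapBPG.anti {c c' aHi Λ θ s : ℝ} (hc : c ≤ c') (h : BondIsoTiltCapBPG c aHi Λ θ s) : BondIsoTiltCapBPG c' aHi Λ θ s := by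
  intro δ hδ a ha Cg hCg K₀ hK₀
  obtain ⟨η₁, hη₁, R₁, hR₁, h1⟩ := h δ hδ a ha Cg hCg K₀ hK₀
  refine ⟨η₁, hη₁, R₁, hR₁, fun S hS hgood η hη hηle R hR L w hLw Ψ hΨ hB hfat => ?_⟩
  obtain ⟨Q, σ, hd, hσ⟩ := h1 S hS hgood η hη hηle R hR L w hLw Ψ hΨ hB hfat
  exact ⟨Q, σ, hd, fun x hx => (hσ x hx).trans hc⟩

/-- VACUITY GUARD (PROVED): the cap `12` always holds (`Q ≡ 1`, `σ ≡ 12`, tear-free `4 ↦ 8`) — the content of [Capᵇ_c] is in `c < 12`. [this file, g53] -/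
theorem bondIsoTiltCapBPG_twelve (aHi Λ θ s : ℝ) : BondIsoTiltCapBPG 12 aHi Λ θ s := by
  intro δ _ a _ Cg _ K₀ _
  refine ⟨1, one_pos, 1, one_pos, fun S _ _ η _ _ R _ L w _ Ψ hΨ _ _ => ?_⟩
  exact ⟨fun _ => LinearIsometryEquiv.refl ℝ E3, fun _ => 12,
    ⟨fun _ => det_refl_E3_eq_one, fun _ => by norm_num, fun x hx p hp hpx => dist_rot_bond_le_twelve hΨ.2.1 _ (atomsIn_subset S _ hx) hp hpx⟩,
    fun _ _ => le_rfl⟩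

/-- ★★★ **THE PLACE OF THE CAP (PROVED): `c ≤ ϑ ⇒ ([Capᵇ_c] ⇒ [Tᵇ])`** — a pointwise cap at or below the tame radius makes every site of `win 9R` `ϑ`-tame
(part UC's dictionary `isTameOn_of_tiltStrainData` with `U := Q x`, `g := Ψ`).  So the small cap is AT LEAST AS STRONG AS [Tᵇ] `TameWindowBPG` — the whole
[T]-axis of the line in the ᵇ-class — and is therefore no lemma beneath it. [this file, g53] -/
theorem tameWindowBPG_of_bondIsoTiltCapBPG {c ϑ aHi Λ θ s : ℝ} (hc : c ≤ ϑ) (h : BondIsoTiltCapBPG c aHi Λ θ s) : TameWindowBPG ϑ aHi Λ θ s := by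
  intro δ hδ a ha Cg hCg K₀ hK₀
  obtain ⟨η₁, hη₁, R₁, hR₁, h1⟩ := h δ hδ a ha Cg hCg K₀ hK₀
  refine ⟨η₁, hη₁, R₁, hR₁, fun S hS hgood η hη hηle R hR L w hLw Ψ hΨ hB hfat => ?_⟩
  obtain ⟨Q, σ, hd, hσ⟩ := h1 S hS hgood η hη hηle R hR L w hLw Ψ hΨ hB hfat
  exact isTameOn_of_tiltStrainData hd hΨ.1.mapsTo fun x hx => (hσ x hx).trans hc

/-- **`c ≤ ϑ ⇒ ([Capᵇ_c] ⇒ [T_bᵇ])` (PROVED)** — through [Tᵇ] (part UK's `bareTameWindowBPG_of_tameWindowBPG`). [this file, g53] -/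
theorem bareTameWindowBPG_of_bondIsoTiltCapBPG {c ϑ ϑe ωe : ℝ} {p : ℕ} {r₀ ℓ : ℝ} {M : ℕ} {aHi Λ θ s : ℝ} (hc : c ≤ ϑ)
    (h : BondIsoTiltCapBPG c aHi Λ θ s) : BareTameWindowBPG ϑ ϑe ωe p r₀ ℓ M aHi Λ θ s :=
  bareTameWindowBPG_of_tameWindowBPG (tameWindowBPG_of_bondIsoTiltCapBPG hc h)

/-- **THE SMALL CAP REPLACES [T_bᵇ] IN THE DOCKET OF RECORD (PROVED)**: `(Mᵇ) StrainNonConcentrationBPG 1 2 (1/16) (1/50) ⟸ Gehring-leaf ∧ [I_D] ∧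
[Capᵇ_c] (c ≤ tameRadius) ∧ [KS] ∧ [W] ∧ [CC°_Wᵇ]` — i.e. the cap lemma at a useful constant is a residual of the SAME strength class as the one it was
meant to serve, not a discharge of it. [this file, g53] -/
theorem strainNonConcentrationBPG_1_50_of_cap {c : ℝ} (hc : c ≤ tameRadius) (hCap : BondIsoTiltCapBPG c 1 2 (1 / 16) (1 / 50))
    (hG : ZatorskaGoldstein2005_localGehringLemmaCounting)
    (hI : DressedCorePG tameRadius dressLevel dressLevel dressExponent 8 collarRadius clusterSize 1 2 (1 / 16) (1 / 50))
    (hKS : KornSobolevPoincareP 1 (1 / 16)) (hW : CoherentWindowPG tameRadius 1 2 (1 / 16) (1 / 50))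
    (hC : CoherentGscCaccioppoliBPG tameRadius 1 2 (1 / 16) (1 / 50)) : StrainNonConcentrationBPG 1 2 (1 / 16) (1 / 50) :=
  strainNonConcentrationBPG_1_50_of_docket hG hI (bareTameWindowBPG_of_bondIsoTiltCapBPG hc hCap) hKS hW hC

/-! ### ZM.3  The link-map dichotomy typed: [LRᵇ_c] «LinkRigidityBP», [PGᵇ_c] «ProperGermBPG», the proved halves -/

/-- ★ **[LRᵇ_c] «LinkRigidityBP c aHi Λ θ s» — LINK RIGIDITY (the dichotomy).**  For every θ-good P-door set `S` (`IsDoorSetP aHi δ S`: separated, two-shell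
clean, single-site Nash, Barlow-bond-charted), every equilibrium `s`-chart `(L, w)` and every bijection `Ψ : S → LayeredHom L w` that is a bond isomorphism,
the germ of `Ψ` at EVERY site is proper-or-improper within `c`: some linear isometry fits the labelled first shell within `c`.  No registration budget, no GSC.
GEOMETRY · TRUE-type for `c ≥ c_iso ≈ 0.27` at the record literals `(aHi, θ, s) = (1, 1/16, 1/50)` (mechanism (i) of the module docstring: all 48 / 12
link automorphisms of the cuboctahedron / anticuboctahedron are isometric — enumerated; `c_iso` = both sets' shell tolerances `1/16 + 1/16` + chart flex
`s` + scale mismatch `(1/9)(17/16)` paid by an isometry) · PROVABLE·M (finite combinatorics of the two link graphs + the clean two-shell fits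
`IsTwoShellAffineGood`) · vacuous-true for `c ≥ 56/25` (PROVED, `linkRigidityBP_of_le`).
Why it might fail: only through the constant — `c` below `c_iso` (the scale mismatch `|a_x − a| ≤ 1/10` between `S`'s local scale and the chart's is
real: breathing patch; an isometry, not a similarity, pays it in full).
Sources: NODE-g53 §1 (calc/links.py); part TG §X (`IsBondIso`: «determined by one site's neighbourhood»); Hales, arXiv 1209.6043; Böröczky–Szabó 2015. [this file, g53] -/
def LinkRigidityBP (c aHi Λ θ s : ℝ) : Prop :=
  ∀ δ : ℝ, 0 < δ → ∀ a : ℝ, 0 < a → ∀ S : Set E3, IsDoorSetP aHi δ S → (∀ q ∈ S, IsTwoShellAffineGood θ S q) →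
    ∀ (L : E3 ≃L[ℝ] E3) (w : ℤ → E3), IsEquilChart a s Λ L w →
      ∀ Ψ : E3 → E3, Set.BijOn Ψ S (LayeredHom (L : E3 →L[ℝ] E3) w) → IsBondIso S Ψ →
        ∀ x ∈ S, IsProperGerm c S Ψ x ∨ IsImproperGerm c S Ψ x

/-- VACUITY GUARD (PROVED): [LRᵇ_c] for `c ≥ 56/25` (identity fit). [this file, g53] -/
theorem linkRigidityBP_of_le {c aHi Λ θ s : ℝ} (hc : 56 / 25 ≤ c) : LinkRigidityBP c aHi Λ θ s :=
  fun _ _ _ _ _ _ _ _ _ _ _ _ hB _ hx => Or.inl ((isProperGerm_of_bondIso hB hx).mono hc)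

/-- ★★ **[PGᵇ_c] «ProperGermBPG c aHi Λ θ s» — EVERY GERM IS PROPER (the dichotomy resolved on registered windows).**  With [T]'s binder prefix and the
clause: every site of `win 9R` has a PROPER germ within `c` (a rotation fits the labelled first shell of `Ψ` at `x` within `c`).  WEAKER than [Capᵇ_c]
(PROVED, `properGermBPG_of_bondIsoTiltCapBPG`: radius `28/25 ≤ 4`); vacuous-true for `c ≥ 56/25` (PROVED).  REGIMES: `c ≳ c_iso ≈ 0.27` GEOMETRY ·
TRUE-type · PROVABLE·M by the module docstring's (i) link rigidity, (iii) handedness continuation along bonds ON SIMILARITY GERMS (chirality gap of the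
shared labelled tripod `0.72 > 3·c_sim ≈ 0.44`, converted to isometries at the end), (iv) proper seed (registration half PROVED:
`exists_profile_lt_of_globalReg`) and the connectedness of the clean contact graph
(`CleanBondPath`-type, part …TearFreeDoor); `c` below the scale window: the first-shell shadow of the small cap, [T]-strength like it.  PAYOFF: defect
exclusion — in the ᵇ-class no improper (mirror / twin-related) germ and no combinatorial core meets a registered window; what is left to [T_bᵇ] is ELASTIC.
Why it might fail: for `c ≳ 0.27` only through the constants (isometry germs alone do NOT inherit handedness at worst-case scales: `3·c_iso ≈ 0.8 > 0.72`;
the proof must pass through similarity germs); for small `c` as [Capᵇ_c].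
Sources: NODE-g53 §1; parts TG §X, TR, UC; critic row 846 (iv). [this file, g53] -/
def ProperGermBPG (c aHi Λ θ s : ℝ) : Prop :=
  ∀ δ : ℝ, 0 < δ → ∀ a : ℝ, 0 < a → ∀ Cg : ℝ, 1 ≤ Cg → ∀ K₀ : ℝ, 0 < K₀ → ∃ η₁ : ℝ, 0 < η₁ ∧ ∃ R₁ : ℝ, 0 < R₁ ∧
    ∀ S : Set E3, IsDoorSetPG aHi δ S → (∀ q ∈ S, IsTwoShellAffineGood θ S q) →
      ∀ η : ℝ, 0 < η → η ≤ η₁ → ∀ R : ℝ, R₁ ≤ R →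
        ∀ (L : E3 ≃L[ℝ] E3) (w : ℤ → E3), IsEquilChart a s Λ L w →
          ∀ Ψ : E3 → E3, IsGlobalReg Cg η R S (LayeredHom (L : E3 →L[ℝ] E3) w) Ψ → IsBondIso S Ψ →
            K₀ ≤ η * nK (atomsIn (μS S) 0 R) →
              ∀ x ∈ atomsIn (μS S) 0 (9 * R), IsProperGerm c S Ψ x

/-- **[Capᵇ_c] ⇒ [PGᵇ_c] (PROVED)** — the cap's rotation field fits the germs. [this file, g53] -/
theorem properGermBPG_of_bondIsoTiltCapBPG {c aHi Λ θ s : ℝ} (h : BondIsoTiltCapBPG c aHi Λ θ s) : ProperGermBPG c aHi Λ θ s := by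
  intro δ hδ a ha Cg hCg K₀ hK₀
  obtain ⟨η₁, hη₁, R₁, hR₁, h1⟩ := h δ hδ a ha Cg hCg K₀ hK₀
  refine ⟨η₁, hη₁, R₁, hR₁, fun S hS hgood η hη hηle R hR L w hLw Ψ hΨ hB hfat x hx => ?_⟩
  obtain ⟨Q, σ, hd, hσ⟩ := h1 S hS hgood η hη hηle R hR L w hLw Ψ hΨ hB hfat
  exact isProperGerm_of_tiltStrainData hd hx (hσ x hx)

/-- VACUITY GUARD (PROVED): [PGᵇ_c] for `c ≥ 56/25`. [this file, g53] -/
theorem properGermBPG_of_le {c aHi Λ θ s : ℝ} (hc : 56 / 25 ≤ c) : ProperGermBPG c aHi Λ θ s :=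
  fun _ _ _ _ _ _ _ _ => ⟨1, one_pos, 1, one_pos, fun S _ _ _ _ _ _ _ _ _ _ _ _ hB _ _ hx => (isProperGerm_of_bondIso hB (atomsIn_subset S _ hx)).mono hc⟩

/-- ★ **PROPER SEED, registration half (PROVED)**: at registration level `Cg·η < t²` some site of `win R` (which contains the origin) has registration
profile `< t` — by Chebyshev on the gradient budget `∑ τ² ≤ Cg·η·#win R` of `IsGlobalReg` at scale `D = R`.  With `t = 1/2` and the chirality gap of an
improper link isometry against the identity (`≥ 0.84·√2 ≈ 1.19 > 1/2 + c` for `c < 0.69`, NODE-g53 §1) that site's germ is not improper within `c` — the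
seed of mechanism (iv). [this file, g53] -/
theorem exists_profile_lt_of_globalReg {δ Cg η R t : ℝ} (hδ : 0 < δ) (hR : 0 < R) (ht : 0 < t) {S H : Set E3} {Ψ : E3 → E3} (hsep : IsSep δ S)
    (h0 : (0 : E3) ∈ S) (hΨ : IsGlobalReg Cg η R S H Ψ) (hκ : Cg * η < t ^ 2) :
    ∃ τ : E3 → ℝ, IsRegistered (Cg * (R / R) * η) 4 R S (atomsIn (μS S) 0 R) H Ψ τ ∧ ∃ x ∈ atomsIn (μS S) 0 R, τ x < t := by
  obtain ⟨τ, hτ⟩ := hΨ.2.2.2 R le_rfl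
  refine ⟨τ, hτ, ?_⟩
  by_contra hcon
  push Not at hcon
  have hfin : (atomsIn (μS S) 0 R).Finite := finite_atomsIn hδ hsep R
  have h0W : (0 : E3) ∈ atomsIn (μS S) 0 R := mem_atomsIn_iff.2 ⟨h0, by rw [norm_zero]; exact hR.le⟩
  have hpos : 0 < nK (atomsIn (μS S) 0 R) := by
    show (0 : ℝ) < ((atomsIn (μS S) 0 R).ncard : ℝ)
    exact_mod_cast (Set.ncard_pos hfin).2 ⟨0, h0W⟩
  have hbudget : ∑ᶠ x ∈ atomsIn (μS S) 0 R, τ x ^ 2 ≤ Cg * (R / R) * η * nK (atomsIn (μS S) 0 R) := hτ.2.2.2.2.1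
  have hlow : t ^ 2 * nK (atomsIn (μS S) 0 R) ≤ ∑ᶠ x ∈ atomsIn (μS S) 0 R, τ x ^ 2 := by
    have hc : t ^ 2 * nK (atomsIn (μS S) 0 R) = ∑ x ∈ hfin.toFinset, t ^ 2 := by
      rw [Finset.sum_const, nsmul_eq_mul]
      show t ^ 2 * ((atomsIn (μS S) 0 R).ncard : ℝ) = _
      rw [Set.ncard_eq_toFinset_card _ hfin, mul_comm]
    rw [finsum_mem_eq_finite_toFinset_sum _ hfin, hc]
    exact Finset.sum_le_sum fun x hx => by
      have h1 : t ≤ τ x := hcon x (hfin.mem_toFinset.1 hx)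
      nlinarith
  have hup : Cg * (R / R) * η * nK (atomsIn (μS S) 0 R) < t ^ 2 * nK (atomsIn (μS S) 0 R) := by
    rw [div_self hR.ne', mul_one]
    exact mul_lt_mul_of_pos_right hκ hpos
  linarith

/-- the literal seed: at level `Cg·η < 1/4` some site of `win R` has profile `< 1/2`. [this file, g53] -/
theorem exists_profile_lt_half_of_globalReg {δ Cg η R : ℝ} (hδ : 0 < δ) (hR : 0 < R) {S H : Set E3} {Ψ : E3 → E3} (hsep : IsSep δ S)
    (h0 : (0 : E3) ∈ S) (hΨ : IsGlobalReg Cg η R S H Ψ) (hκ : Cg * η < 1 / 4) :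
    ∃ τ : E3 → ℝ, IsRegistered (Cg * (R / R) * η) 4 R S (atomsIn (μS S) 0 R) H Ψ τ ∧ ∃ x ∈ atomsIn (μS S) 0 R, τ x < 1 / 2 :=
  exists_profile_lt_of_globalReg hδ hR (by norm_num) hsep h0 hΨ (by norm_num; linarith)

end Summit.AtomisticToContinuum.Crystallization.Theorems.ChartedZeroExcessLayeredLatticeLiouville

end
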